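import Mathlib

/-!
# Crux `PolyMobiusTail` (stmt-Parity-0870), line `eta-free-multilinear-window`, stub `stub_pair_middle`
# — helper 6: the cofactor reparametrisation of the one-sided middle sum

For a pair `fᵢ = qᵢX + aᵢ` (`qᵢ ≥ 1`) the one-sided middle sum over `n ≤ x` and divisor tuples `d ∣ f(n)` equals
the triple sum over `(d₀, d₁, m)` with `f₁(n) = d₁·m`, `n = (d₁m − a₁)/q₁` (conditions C1, C3, C2⁺, C2, window, C5).
Head: the registered auxiliary stub `stub_pair_middle_reparam`.
-/

open scoped BigOperators
open Finset Real Filter Polynomial Asymptotics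

namespace Summit.Parity.BatemanHorn.Theorems.PolyMobiusTail.EtaFreeWindow

namespace MiddleAssembly


/-- A polynomial of degree one evaluates as `lc · n + c₀`. -/
theorem eval_eq_of_natDegree_eq_one (g : ℤ[X]) (h : g.natDegree = 1) (n : ℤ) :
    g.eval n = g.leadingCoeff * n + g.coeff 0 := by
  have h2 : g.eval n = ∑ i ∈ Finset.range (g.natDegree + 1), g.coeff i * n ^ i :=
    Polynomial.eval_eq_sum_range n
  rw [h2, h, Finset.sum_range_succ, Finset.sum_range_succ, Finset.sum_range_zero]
  have hlc : g.leadingCoeff = g.coeff 1 := by rw [Polynomial.leadingCoeff, h]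
  rw [hlc]; ring

/-- Sums over `Fintype.piFinset` on `Fin 2` are iterated sums. -/
theorem sum_piFinset_fin_two (t : Fin 2 → Finset ℕ) (g : (Fin 2 → ℕ) → ℝ) :
    ∑ d ∈ Fintype.piFinset t, g d = ∑ a ∈ t 0, ∑ b ∈ t 1, g ![a, b] := by
  rw [← Finset.sum_product']
  refine Finset.sum_nbij' (fun d => (d 0, d 1)) (fun p => ![p.1, p.2]) ?_ ?_ ?_ ?_ ?_
  · intro d hd
    rw [Fintype.mem_piFinset] at hd
    exact Finset.mem_product.mpr ⟨hd 0, hd 1⟩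
  · intro p hp
    rw [Finset.mem_product] at hp
    rw [Fintype.mem_piFinset]
    intro i
    fin_cases i
    · exact hp.1
    · exact hp.2
  · intro d _
    funext i
    fin_cases i <;> rfl
  · intro p _
    rfl
  · intro d _
    congr 1
    funext i
    fin_cases i <;> rfl

/-- The divisors of `v⁺` (for an integer `v ≤ Xb`) as an indicator over `1 ≤ d ≤ Xb`. -/
theorem sum_divisors_toNat_eq (v : ℤ) (Xb : ℕ) (hv : v ≤ Xb) (h : ℕ → ℝ) :
    ∑ d ∈ (v.toNat).divisors, h d =
      ∑ d ∈ Finset.Icc 1 Xb, if (1 ≤ v ∧ (d : ℤ) ∣ v) then h d else 0 := by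
  rw [← Finset.sum_filter]
  refine Finset.sum_congr ?_ fun _ _ => rfl
  ext d
  rw [Nat.mem_divisors, Finset.mem_filter, Finset.mem_Icc]
  constructor
  · rintro ⟨hd, hv0⟩
    have hvpos : 0 < v.toNat := Nat.pos_of_ne_zero hv0
    have hv1 : 1 ≤ v := by
      have := Int.toNat_of_nonneg (Int.lt_toNat.mp (by simpa using hvpos)).le
      omega
    have hvn : (v.toNat : ℤ) = v := Int.toNat_of_nonneg (by omega)
    have hdpos : 0 < d := Nat.pos_of_dvd_of_pos hd hvpos
    have hdle : d ≤ v.toNat := Nat.le_of_dvd hvpos hd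
    refine ⟨⟨hdpos, ?_⟩, hv1, ?_⟩
    · have : (d : ℤ) ≤ Xb := by
        calc (d : ℤ) ≤ v.toNat := by exact_mod_cast hdle
          _ = v := hvn
          _ ≤ Xb := hv
      exact_mod_cast this
    · rw [← hvn]; exact_mod_cast hd
  · rintro ⟨⟨hd1, -⟩, hv1, hdv⟩
    have hvn : (v.toNat : ℤ) = v := Int.toNat_of_nonneg (by omega)
    refine ⟨?_, ?_⟩
    · rw [← hvn] at hdv; exact_mod_cast hdv
    · have : 0 < v.toNat := by
        have : (0 : ℤ) < v.toNat := by rw [hvn]; omega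
        exact_mod_cast this
      exact this.ne'

/-- Reparametrising `n ≤ x` with `d₁ ∣ q₁n + a₁ ≥ 1` by the cofactor `m = (q₁n + a₁)/d₁`. -/
theorem sum_Icc_reparam (q₁ a₁ : ℤ) (hq₁ : 0 < q₁) (d₁ : ℕ) (hd₁ : 0 < d₁) (x Xb : ℕ)
    (hXb : q₁ * x + a₁ ≤ Xb) (H : ℤ → ℝ) :
    ∑ n ∈ Finset.Icc 1 x, (if 1 ≤ q₁ * n + a₁ ∧ (d₁ : ℤ) ∣ q₁ * n + a₁ then H n else 0) =
    ∑ m ∈ Finset.Icc 1 Xb, (if ((d₁ : ℤ) * m - a₁) % q₁ = 0 ∧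
        (1 ≤ ((d₁ : ℤ) * m - a₁) / q₁ ∧ ((d₁ : ℤ) * m - a₁) / q₁ ≤ x)
        then H (((d₁ : ℤ) * m - a₁) / q₁) else 0) := by
  rw [← Finset.sum_filter, ← Finset.sum_filter]
  have hd₁z : (0 : ℤ) < d₁ := by exact_mod_cast hd₁
  refine Finset.sum_nbij' (fun n : ℕ => ((q₁ * n + a₁) / d₁).toNat)
    (fun m : ℕ => (((d₁ : ℤ) * m - a₁) / q₁).toNat) ?_ ?_ ?_ ?_ ?_
  · -- maps into the target
    intro n hn
    rw [Finset.mem_filter, Finset.mem_Icc] at hn ⊢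
    obtain ⟨⟨hn1, hnx⟩, hv1, hdv⟩ := hn
    obtain ⟨k, hk⟩ := hdv
    have hk1 : 1 ≤ k := by
      by_contra h
      push Not at h
      have : (d₁ : ℤ) * k ≤ 0 := by nlinarith
      omega
    have hkdef : (q₁ * n + a₁) / d₁ = k := by
      rw [hk, Int.mul_ediv_cancel_left _ hd₁z.ne']
    rw [hkdef]
    have hkle : k ≤ Xb := by
      have h1 : (d₁ : ℤ) * k ≤ q₁ * x + a₁ := by
        rw [← hk]; have : (n : ℤ) ≤ x := by exact_mod_cast hnx
        nlinarith
      have h2 : k ≤ (d₁ : ℤ) * k := by nlinarith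
      omega
    have hkk : ((k.toNat : ℕ) : ℤ) = k := Int.toNat_of_nonneg (by omega)
    refine ⟨⟨by omega, by omega⟩, ?_⟩
    rw [hkk, show (d₁ : ℤ) * k - a₁ = q₁ * n by rw [← hk]; ring, Int.mul_emod_right,
      Int.mul_ediv_cancel_left _ hq₁.ne']
    exact ⟨rfl, by exact_mod_cast hn1, by exact_mod_cast hnx⟩
  · intro m hm
    rw [Finset.mem_filter, Finset.mem_Icc] at hm ⊢
    obtain ⟨⟨hm1, hmX⟩, hmod, hn1, hnx⟩ := hm
    set nn : ℤ := ((d₁ : ℤ) * m - a₁) / q₁ with hnn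
    have hq : q₁ * nn = (d₁ : ℤ) * m - a₁ := Int.mul_ediv_cancel' (Int.dvd_of_emod_eq_zero hmod)
    have hnnn : ((nn.toNat : ℕ) : ℤ) = nn := Int.toNat_of_nonneg (by omega)
    refine ⟨⟨by omega, by omega⟩, ?_, ?_⟩
    · rw [hnnn, hq]
      have : (1 : ℤ) ≤ (d₁ : ℤ) * m := by
        have h1 : (1 : ℤ) ≤ d₁ := by exact_mod_cast hd₁
        have h2 : (1 : ℤ) ≤ m := by exact_mod_cast hm1
        nlinarith
      omega
    · rw [hnnn, hq]
      exact ⟨m, by ring⟩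
  · -- left inverse
    intro n hn
    rw [Finset.mem_filter, Finset.mem_Icc] at hn
    obtain ⟨⟨hn1, hnx⟩, hv1, hdv⟩ := hn
    obtain ⟨k, hk⟩ := hdv
    have hk0 : 0 ≤ k := by nlinarith
    have hkdef : (q₁ * n + a₁) / d₁ = k := by
      rw [hk, Int.mul_ediv_cancel_left _ hd₁z.ne']
    simp only [hkdef, Int.toNat_of_nonneg hk0]
    rw [show (d₁ : ℤ) * k - a₁ = q₁ * n by rw [← hk]; ring, Int.mul_ediv_cancel_left _ hq₁.ne']
    exact Int.toNat_natCast n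
  · -- right inverse
    intro m hm
    rw [Finset.mem_filter, Finset.mem_Icc] at hm
    obtain ⟨⟨hm1, hmX⟩, hmod, hn1, hnx⟩ := hm
    set nn : ℤ := ((d₁ : ℤ) * m - a₁) / q₁ with hnn
    have hq : q₁ * nn = (d₁ : ℤ) * m - a₁ := Int.mul_ediv_cancel' (Int.dvd_of_emod_eq_zero hmod)
    simp only [Int.toNat_of_nonneg (show (0 : ℤ) ≤ nn by omega)]
    rw [show q₁ * nn + a₁ = (d₁ : ℤ) * m by rw [hq]; ring, Int.mul_ediv_cancel_left _ hd₁z.ne']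
    exact Int.toNat_natCast m
  · -- values agree
    intro n hn
    rw [Finset.mem_filter, Finset.mem_Icc] at hn
    obtain ⟨⟨hn1, hnx⟩, hv1, hdv⟩ := hn
    obtain ⟨k, hk⟩ := hdv
    have hk0 : 0 ≤ k := by nlinarith
    have hkdef : (q₁ * n + a₁) / d₁ = k := by
      rw [hk, Int.mul_ediv_cancel_left _ hd₁z.ne']
    simp only [hkdef, Int.toNat_of_nonneg hk0]
    rw [show (d₁ : ℤ) * k - a₁ = q₁ * n by rw [← hk]; ring, Int.mul_ediv_cancel_left _ hq₁.ne']

/-- **O1 (reparametrisation).** For a pair of degree-one polynomials `fᵢ = qᵢ X + aᵢ` with `qᵢ ≥ 1`, and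
`Xb` at least `max(q₀,q₁)·x + |a₀| + |a₁|`, the one-sided middle sum equals the `(d₀,d₁,m)` triple sum. -/
theorem oneSided_eq_tripleSum (f : Fin 2 → ℤ[X]) (hdeg : ∀ i, (f i).natDegree = 1)
    (hq : ∀ i, 0 < (f i).leadingCoeff) (σ₁ σ₂ θ η : ℝ) (x Xb : ℕ)
    (hXb : ((f 0).leadingCoeff.toNat + (f 1).leadingCoeff.toNat) * x + ((f 0).coeff 0).natAbs +
      ((f 1).coeff 0).natAbs ≤ Xb) :
    (∑ n ∈ Finset.Icc 1 x, ∑ d ∈ Fintype.piFinset (fun i => (((f i).eval (n : ℤ)).toNat).divisors),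
      if (x : ℝ) ^ (1 - η) < ∏ i, (d i : ℝ) ∧ ∏ i, (d i : ℝ) ≤ (x : ℝ) ^ (1 + θ) ∧
          ((x : ℝ) ^ σ₁ < (d 0 : ℝ) ∧ (d 0 : ℝ) ≤ (x : ℝ) ^ σ₂) then
        (∏ i, ((ArithmeticFunction.moebius (d i) : ℝ) * Real.log (d i))) else 0) =
    (∑ d₀ ∈ Finset.Icc 1 Xb, ∑ d₁ ∈ Finset.Icc 1 Xb, ∑ m ∈ Finset.Icc 1 Xb,
      if ((d₁ : ℤ) * m - ((f 1).coeff 0)) % (f 1).leadingCoeff = 0 ∧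
          (1 ≤ ((d₁ : ℤ) * m - ((f 1).coeff 0)) / (f 1).leadingCoeff ∧ ((d₁ : ℤ) * m - ((f 1).coeff 0)) / (f 1).leadingCoeff ≤ x) ∧
          (1 ≤ (f 0).leadingCoeff * (((d₁ : ℤ) * m - ((f 1).coeff 0)) / (f 1).leadingCoeff) + ((f 0).coeff 0) ∧ (d₀ : ℤ) ∣ (f 0).leadingCoeff * (((d₁ : ℤ) * m - ((f 1).coeff 0)) / (f 1).leadingCoeff) + ((f 0).coeff 0)) ∧
          ((x : ℝ) ^ (1 - η) < (d₀ : ℝ) * d₁ ∧ (d₀ : ℝ) * d₁ ≤ (x : ℝ) ^ (1 + θ) ∧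
            ((x : ℝ) ^ σ₁ < (d₀ : ℝ) ∧ (d₀ : ℝ) ≤ (x : ℝ) ^ σ₂)) then
        ((ArithmeticFunction.moebius d₀ : ℝ) * Real.log d₀) * ((ArithmeticFunction.moebius d₁ : ℝ) * Real.log d₁)
      else 0) := by
  set q₀ : ℤ := (f 0).leadingCoeff with hq₀
  set a₀ : ℤ := (f 0).coeff 0 with ha₀
  set q₁ : ℤ := (f 1).leadingCoeff with hq₁
  set a₁ : ℤ := (f 1).coeff 0 with ha₁
  have hq₀p : 0 < q₀ := hq 0
  have hq₁p : 0 < q₁ := hq 1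
  have hev0 : ∀ n : ℤ, (f 0).eval n = q₀ * n + a₀ := eval_eq_of_natDegree_eq_one _ (hdeg 0)
  have hev1 : ∀ n : ℤ, (f 1).eval n = q₁ * n + a₁ := eval_eq_of_natDegree_eq_one _ (hdeg 1)
  -- size bounds: `qᵢ n + aᵢ ≤ Xb` for `n ≤ x`
  have hXb' : ∀ n : ℕ, n ≤ x → q₀ * n + a₀ ≤ Xb ∧ q₁ * n + a₁ ≤ Xb := by
    intro n hn
    have hX : (((q₀.toNat + q₁.toNat) * x + a₀.natAbs + a₁.natAbs : ℕ) : ℤ) ≤ Xb := by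
      exact_mod_cast hXb
    push_cast at hX
    have e0 : (q₀.toNat : ℤ) = q₀ := Int.toNat_of_nonneg hq₀p.le
    have e1 : (q₁.toNat : ℤ) = q₁ := Int.toNat_of_nonneg hq₁p.le
    rw [e0, e1] at hX
    have hn' : (n : ℤ) ≤ x := by exact_mod_cast hn
    have ha0 : a₀ ≤ |a₀| := le_abs_self _
    have ha1 : a₁ ≤ |a₁| := le_abs_self _
    have ha0' : 0 ≤ |a₀| := abs_nonneg _
    have ha1' : 0 ≤ |a₁| := abs_nonneg _
    have h0x : (0 : ℤ) ≤ x := by positivity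
    have m0 : q₀ * (n : ℤ) ≤ q₀ * x := mul_le_mul_of_nonneg_left hn' hq₀p.le
    have m1 : q₁ * (n : ℤ) ≤ q₁ * x := mul_le_mul_of_nonneg_left hn' hq₁p.le
    have m2 : 0 ≤ q₀ * (x : ℤ) := mul_nonneg hq₀p.le h0x
    have m3 : 0 ≤ q₁ * (x : ℤ) := mul_nonneg hq₁p.le h0x
    constructor <;> nlinarith
  -- the weight of `![a, b]`
  have hw : ∀ a b : ℕ, (∏ i, ((ArithmeticFunction.moebius ((![a, b] : Fin 2 → ℕ) i) : ℝ) * Real.log ((![a, b] : Fin 2 → ℕ) i))) =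
      ((ArithmeticFunction.moebius a : ℝ) * Real.log a) * ((ArithmeticFunction.moebius b : ℝ) * Real.log b) := by
    intro a b
    simp [Fin.prod_univ_two]
  have hprod : ∀ a b : ℕ, (∏ i, ((![a, b] : Fin 2 → ℕ) i : ℝ)) = (a : ℝ) * b := by
    intro a b
    simp [Fin.prod_univ_two]
  -- Step 1: `piFinset` over `Fin 2` as an iterated sum; Step 2: divisor sums as indicators
  have step : ∀ n ∈ Finset.Icc 1 x,
      (∑ d ∈ Fintype.piFinset (fun i => (((f i).eval (n : ℤ)).toNat).divisors),
        if (x : ℝ) ^ (1 - η) < ∏ i, (d i : ℝ) ∧ ∏ i, (d i : ℝ) ≤ (x : ℝ) ^ (1 + θ) ∧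
            ((x : ℝ) ^ σ₁ < (d 0 : ℝ) ∧ (d 0 : ℝ) ≤ (x : ℝ) ^ σ₂) then
            (∏ i, ((ArithmeticFunction.moebius (d i) : ℝ) * Real.log (d i))) else 0) =
      ∑ d₀ ∈ Finset.Icc 1 Xb, ∑ d₁ ∈ Finset.Icc 1 Xb,
        if 1 ≤ q₁ * n + a₁ ∧ (d₁ : ℤ) ∣ q₁ * n + a₁ then
          (if 1 ≤ q₀ * n + a₀ ∧ (d₀ : ℤ) ∣ q₀ * n + a₀ then
            (if (x : ℝ) ^ (1 - η) < (d₀ : ℝ) * d₁ ∧ (d₀ : ℝ) * d₁ ≤ (x : ℝ) ^ (1 + θ) ∧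
                ((x : ℝ) ^ σ₁ < (d₀ : ℝ) ∧ (d₀ : ℝ) ≤ (x : ℝ) ^ σ₂) then
              ((ArithmeticFunction.moebius d₀ : ℝ) * Real.log d₀) *
                ((ArithmeticFunction.moebius d₁ : ℝ) * Real.log d₁) else 0) else 0) else 0 := by
    intro n hn
    have hnx : n ≤ x := (Finset.mem_Icc.mp hn).2
    rw [sum_piFinset_fin_two]
    simp only [Fin.isValue, Matrix.cons_val_zero, hprod, hw]
    rw [hev0, hev1]
    rw [sum_divisors_toNat_eq (q₀ * n + a₀) Xb (hXb' n hnx).1]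
    refine Finset.sum_congr rfl fun d₀ _ => ?_
    by_cases h0 : 1 ≤ q₀ * (n : ℤ) + a₀ ∧ (d₀ : ℤ) ∣ q₀ * (n : ℤ) + a₀
    · rw [if_pos h0, sum_divisors_toNat_eq (q₁ * n + a₁) Xb (hXb' n hnx).2]
      refine Finset.sum_congr rfl fun d₁ _ => ?_
      by_cases h1 : 1 ≤ q₁ * (n : ℤ) + a₁ ∧ (d₁ : ℤ) ∣ q₁ * (n : ℤ) + a₁
      · rw [if_pos h1, if_pos h1, if_pos h0]
      · rw [if_neg h1, if_neg h1]
    · rw [if_neg h0]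
      symm
      refine Finset.sum_eq_zero fun d₁ _ => ?_
      rw [if_neg h0]
      split_ifs <;> rfl
  rw [Finset.sum_congr rfl step]
  -- Step 3: bring `n` inside
  rw [Finset.sum_comm]
  refine Finset.sum_congr rfl fun d₀ hd₀ => ?_
  rw [Finset.sum_comm]
  refine Finset.sum_congr rfl fun d₁ hd₁ => ?_
  have hd₁pos : 0 < d₁ := (Finset.mem_Icc.mp hd₁).1
  -- Step 4: reparametrise `n ↦ m = (q₁ n + a₁)/d₁`
  have hXb1 : q₁ * x + a₁ ≤ Xb := (hXb' x le_rfl).2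
  rw [sum_Icc_reparam q₁ a₁ hq₁p d₁ hd₁pos x Xb hXb1 (fun z : ℤ =>
    if 1 ≤ q₀ * z + a₀ ∧ (d₀ : ℤ) ∣ q₀ * z + a₀ then
      (if (x : ℝ) ^ (1 - η) < (d₀ : ℝ) * d₁ ∧ (d₀ : ℝ) * d₁ ≤ (x : ℝ) ^ (1 + θ) ∧
          ((x : ℝ) ^ σ₁ < (d₀ : ℝ) ∧ (d₀ : ℝ) ≤ (x : ℝ) ^ σ₂) then
        ((ArithmeticFunction.moebius d₀ : ℝ) * Real.log d₀) *
          ((ArithmeticFunction.moebius d₁ : ℝ) * Real.log d₁) else 0) else 0)]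
  refine Finset.sum_congr rfl fun m _ => ?_
  simp only [← ite_and, and_assoc]



end MiddleAssembly

/-- **Auxiliary stub `stub_pair_middle_reparam`** (head of this helper file; parent stub `stub_pair_middle`):
the one-sided middle sum of a degree-one pair equals its `(d₀,d₁,m)` triple sum — `MiddleAssembly.oneSided_eq_tripleSum`. -/
theorem stub_pair_middle_reparam : ∀ (f : Fin 2 → ℤ[X]), (∀ i, (f i).natDegree = 1) → (∀ i, 0 < (f i).leadingCoeff) →
    ∀ (σ₁ σ₂ θ η : ℝ) (x Xb : ℕ),
    ((f 0).leadingCoeff.toNat + (f 1).leadingCoeff.toNat) * x + ((f 0).coeff 0).natAbs + ((f 1).coeff 0).natAbs ≤ Xb →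
    (∑ n ∈ Finset.Icc 1 x, ∑ d ∈ Fintype.piFinset (fun i => (((f i).eval (n : ℤ)).toNat).divisors), if (x : ℝ) ^ (1 - η) < ∏ i, (d i : ℝ) ∧ ∏ i, (d i : ℝ) ≤ (x : ℝ) ^ (1 + θ) ∧ ((x : ℝ) ^ σ₁ < (d 0 : ℝ) ∧ (d 0 : ℝ) ≤ (x : ℝ) ^ σ₂) then (∏ i, ((ArithmeticFunction.moebius (d i) : ℝ) * Real.log (d i))) else 0) = (∑ d₀ ∈ Finset.Icc 1 Xb, ∑ d₁ ∈ Finset.Icc 1 Xb, ∑ m ∈ Finset.Icc 1 Xb, if ((d₁ : ℤ) * m - ((f 1).coeff 0)) % (f 1).leadingCoeff = 0 ∧ (1 ≤ ((d₁ : ℤ) * m - ((f 1).coeff 0)) / (f 1).leadingCoeff ∧ ((d₁ : ℤ) * m - ((f 1).coeff 0)) / (f 1).leadingCoeff ≤ x) ∧ (1 ≤ (f 0).leadingCoeff * (((d₁ : ℤ) * m - ((f 1).coeff 0)) / (f 1).leadingCoeff) + ((f 0).coeff 0) ∧ (d₀ : ℤ) ∣ (f 0).leadingCoeff * (((d₁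 : ℤ) * m - ((f 1).coeff 0)) / (f 1).leadingCoeff) + ((f 0).coeff 0)) ∧ ((x : ℝ) ^ (1 - η) < (d₀ : ℝ) * d₁ ∧ (d₀ : ℝ) * d₁ ≤ (x : ℝ) ^ (1 + θ) ∧ ((x : ℝ) ^ σ₁ < (d₀ : ℝ) ∧ (d₀ : ℝ) ≤ (x : ℝ) ^ σ₂)) then ((ArithmeticFunction.moebius d₀ : ℝ) * Real.log d₀) * ((ArithmeticFunction.moebius d₁ : ℝ) * Real.log d₁) else 0) :=
  fun f hdeg hq σ₁ σ₂ θ η x Xb hXb => MiddleAssembly.oneSided_eq_tripleSum f hdeg hq σ₁ σ₂ θ η x Xb hXb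

end Summit.Parity.BatemanHorn.Theorems.PolyMobiusTail.EtaFreeWindow
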